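/-
HONEST FRAMING: certified error envelopes and provably optimal rounding/accumulation schemes for
low-precision formats under stated cost models; every table by two implementations; no hardware
or vendor claims.
-/
import Mathlib.Algebra.BigOperators.Field
import Summits.Ventures.CertifiedArithmetic.LowPrec.OptDemotionRouting

/-!
# The demotion law (Theorem T8), part 8i′: values of bit configurations (the float grid)

Bookkeeping for parts 8h–8n (midpoint convexity, monotonicity, the descent): `val S = Σ_{e ∈ S} 2^e`, a
configuration is worth less than twice its top bit (`val_lt_two_zpow`), binary expansions are
unique (`eq_of_val_eq`), a configuration above `2^ℓ` is worth a natural multiple of `2^ℓ`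
(`val_eq_nat_mul`), two routable configurations with `val S < val S'` differ by at least
`ulp(S) = 2^(max S + 1 - q)` (`val_succ_le_of_lt`), and the value of a run of consecutive bits
(`val_run`).
-/

namespace Summit.Ventures.CertifiedArithmetic.LowPrec.Opt

open Literature.ComputerArithmetic.JeannerodRump2018
open Literature.ComputerArithmetic.JeannerodRump2018.SumTree

/-! ## A run of bits -/

/-- The geometric sum of a run of bits: `Σ_{i ≤ j} 2^(β+i) = 2^(β+j+1) - 2^β`. -/
theorem sum_run_pow (β : ℤ) : ∀ j : ℕ,
    ∑ i ∈ Finset.range (j + 1), (2 : ℚ) ^ (β + (i : ℤ)) = (2 : ℚ) ^ (β + ((j : ℤ) + 1)) - (2 : ℚ) ^ β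
  | 0 => by simp [zpow_add_one₀ (two_ne_zero : (2 : ℚ) ≠ 0)]; ring
  | j + 1 => by
      rw [Finset.sum_range_succ, sum_run_pow β j]
      push_cast
      rw [show β + ((j : ℤ) + 1 + 1) = (β + ((j : ℤ) + 1)) + 1 by ring,
        zpow_add_one₀ (two_ne_zero : (2 : ℚ) ≠ 0)]
      ring

/-! ## Values of configurations -/

/-- The value of a configuration of bits. -/
def val (S : Finset ℤ) : ℚ := ∑ e ∈ S, (2 : ℚ) ^ e

/-- `val ∅ = 0`. -/
@[simp] theorem val_empty : val ∅ = 0 := by simp [val]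

/-- `val (insert e S) = 2^e + val S` for `e ∉ S`. -/
theorem val_insert {e : ℤ} {S : Finset ℤ} (h : e ∉ S) : val (insert e S) = (2 : ℚ) ^ e + val S := by
  unfold val; rw [Finset.sum_insert h]

/-- `val S = 2^e + val (S.erase e)` for `e ∈ S`. -/
theorem val_eq_add_erase {e : ℤ} {S : Finset ℤ} (h : e ∈ S) : val S = (2 : ℚ) ^ e + val (S.erase e) := by
  unfold val; rw [Finset.add_sum_erase S _ h]

/-- `val ≥ 0`. -/
theorem val_nonneg (S : Finset ℤ) : 0 ≤ val S :=
  Finset.sum_nonneg fun e _ => (zpow_pos (by norm_num : (0 : ℚ) < 2) e).le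

/-- A configuration is worth less than twice its top bit. -/
theorem val_lt_two_zpow : ∀ (S : Finset ℤ) (hne : S.Nonempty), val S < 2 * (2 : ℚ) ^ (S.max' hne) := by
  intro S
  induction S using Finset.strongInduction with
  | H S ih =>
      intro hne
      set m := S.max' hne with hm
      have hmS : m ∈ S := Finset.max'_mem S hne
      rw [val_eq_add_erase hmS]
      by_cases h : (S.erase m).Nonempty
      · have hlt := ih (S.erase m) (Finset.erase_ssubset hmS) h
        have hm' : (S.erase m).max' h < m := by
          have h1 : (S.erase m).max' h ≤ m := Finset.le_max' S _ (Finset.mem_of_mem_erase (Finset.max'_mem _ h))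
          have h2 : (S.erase m).max' h ≠ m := Finset.ne_of_mem_erase (Finset.max'_mem _ h)
          exact lt_of_le_of_ne h1 h2
        have : 2 * (2 : ℚ) ^ ((S.erase m).max' h) ≤ (2 : ℚ) ^ m := by
          rw [← zpow_one_add₀ (two_ne_zero), add_comm]
          exact zpow_le_zpow_right₀ (by norm_num) (by omega)
        linarith
      · rw [Finset.not_nonempty_iff_eq_empty.1 h, val_empty]
        have := zpow_pos (by norm_num : (0 : ℚ) < 2) m; linarith

/-- A nonempty configuration is worth at least its top bit. -/
theorem two_zpow_le_val {S : Finset ℤ} (hne : S.Nonempty) : (2 : ℚ) ^ (S.max' hne) ≤ val S := by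
  rw [val_eq_add_erase (Finset.max'_mem S hne)]
  linarith [val_nonneg (S.erase (S.max' hne))]

/-- The value determines the top … -/
theorem max'_eq_of_val_eq {S S' : Finset ℤ} (hne : S.Nonempty) (hne' : S'.Nonempty) (h : val S = val S') :
    S.max' hne = S'.max' hne' := by
  by_contra hne2
  rcases lt_or_gt_of_ne hne2 with hlt | hgt
  · have h1 := val_lt_two_zpow S hne
    have h2 := two_zpow_le_val hne'
    have : 2 * (2 : ℚ) ^ (S.max' hne) ≤ (2 : ℚ) ^ (S'.max' hne') := by
      rw [← zpow_one_add₀ (two_ne_zero), add_comm]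
      exact zpow_le_zpow_right₀ (by norm_num) (by omega)
    linarith
  · have h1 := val_lt_two_zpow S' hne'
    have h2 := two_zpow_le_val hne
    have : 2 * (2 : ℚ) ^ (S'.max' hne') ≤ (2 : ℚ) ^ (S.max' hne) := by
      rw [← zpow_one_add₀ (two_ne_zero), add_comm]
      exact zpow_le_zpow_right₀ (by norm_num) (by omega)
    linarith

/-- … and the whole configuration (uniqueness of binary expansions). -/
theorem eq_of_val_eq : ∀ (S S' : Finset ℤ), val S = val S' → S = S' := by
  intro S
  induction S using Finset.strongInduction with
  | H S ih =>
      intro S' h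
      by_cases hne : S.Nonempty
      · have hne' : S'.Nonempty := by
          by_contra h'
          rw [Finset.not_nonempty_iff_eq_empty.1 h', val_empty] at h
          have := two_zpow_le_val hne
          have := zpow_pos (by norm_num : (0 : ℚ) < 2) (S.max' hne); linarith
        have hm := max'_eq_of_val_eq hne hne' h
        have hmS := Finset.max'_mem S hne
        have hmS' := Finset.max'_mem S' hne'
        have h' : val (S.erase (S.max' hne)) = val (S'.erase (S'.max' hne')) := by
          have e1 := val_eq_add_erase hmS
          have e2 := val_eq_add_erase hmS'
          have e3 : (2 : ℚ) ^ (S.max' hne) = (2 : ℚ) ^ (S'.max' hne') := by rw [hm]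
          linarith
        have := ih _ (Finset.erase_ssubset hmS) _ h'
        calc S = insert (S.max' hne) (S.erase (S.max' hne)) := (Finset.insert_erase hmS).symm
          _ = insert (S'.max' hne') (S'.erase (S'.max' hne')) := by rw [this, hm]
          _ = S' := Finset.insert_erase hmS'
      · rw [Finset.not_nonempty_iff_eq_empty.1 hne] at h ⊢
        by_contra h'
        have hne' : S'.Nonempty := Finset.nonempty_iff_ne_empty.2 (Ne.symm h')
        rw [val_empty] at h
        have := two_zpow_le_val hne'
        have := zpow_pos (by norm_num : (0 : ℚ) < 2) (S'.max' hne'); linarith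

/-- A configuration above the grid `2^ℓ` is worth a natural multiple of `2^ℓ`. -/
theorem val_eq_nat_mul {S : Finset ℤ} {ℓ : ℤ} (h : ∀ e ∈ S, ℓ ≤ e) :
    ∃ N : ℕ, val S = N * (2 : ℚ) ^ ℓ := by
  classical
  refine ⟨∑ e ∈ S, 2 ^ (e - ℓ).toNat, ?_⟩
  unfold val
  rw [Nat.cast_sum, Finset.sum_mul]
  refine Finset.sum_congr rfl fun e he => ?_
  push_cast
  rw [← zpow_natCast, ← zpow_add₀ (two_ne_zero)]
  congr 1
  rw [Int.toNat_of_nonneg (by linarith [h e he])]; ring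

/-- THE FLOAT GRID: two routable nonempty configurations with `val S < val S'` differ by at least
`ulp(S) = 2^(max S + 1 - q)`. -/
theorem val_succ_le_of_lt {q : ℕ} {S S' : Finset ℤ} (hne : S.Nonempty) (hne' : S'.Nonempty)
    (hS : Routable q S) (hS' : Routable q S') (h : val S < val S') :
    val S + (2 : ℚ) ^ (S.max' hne + 1 - q) ≤ val S' := by
  set ℓ := S.max' hne + 1 - q with hℓ
  -- S' reaches at least as high as S
  have htop : S.max' hne ≤ S'.max' hne' := by
    by_contra hlt
    have hlt := not_le.1 hlt
    have h1 := val_lt_two_zpow S' hne'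
    have h2 := two_zpow_le_val hne
    have : 2 * (2 : ℚ) ^ (S'.max' hne') ≤ (2 : ℚ) ^ (S.max' hne) := by
      rw [← zpow_one_add₀ (two_ne_zero), add_comm]
      exact zpow_le_zpow_right₀ (by norm_num) (by omega)
    linarith
  -- both values are multiples of 2^ℓ
  have hSℓ : ∀ e ∈ S, ℓ ≤ e := fun e he => by
    have := hS (S.max' hne) (Finset.max'_mem S hne) e he; rw [hℓ]; linarith
  have hS'ℓ : ∀ e ∈ S', ℓ ≤ e := fun e he => by
    have := hS' (S'.max' hne') (Finset.max'_mem S' hne') e he; rw [hℓ]; linarith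
  obtain ⟨N, hN⟩ := val_eq_nat_mul hSℓ
  obtain ⟨N', hN'⟩ := val_eq_nat_mul hS'ℓ
  have hpos : (0 : ℚ) < (2 : ℚ) ^ ℓ := zpow_pos (by norm_num) _
  rw [hN, hN'] at h ⊢
  have : N < N' := by
    by_contra hle
    have : (N' : ℚ) ≤ N := by exact_mod_cast not_lt.1 hle
    nlinarith
  have : (N : ℚ) + 1 ≤ N' := by exact_mod_cast this
  nlinarith


/-- A larger value reaches at least as high. -/
theorem max'_le_of_val_le {S S' : Finset ℤ} (hne : S.Nonempty) (hne' : S'.Nonempty) (h : val S ≤ val S') :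
    S.max' hne ≤ S'.max' hne' := by
  by_contra hlt
  have hlt := not_le.1 hlt
  have h1 := val_lt_two_zpow S' hne'
  have h2 := two_zpow_le_val hne
  have : 2 * (2 : ℚ) ^ (S'.max' hne') ≤ (2 : ℚ) ^ (S.max' hne) := by
    rw [← zpow_one_add₀ (two_ne_zero), add_comm]
    exact zpow_le_zpow_right₀ (by norm_num) (by omega)
  linarith

/-- `val` splits over a subset. -/
theorem val_eq_sdiff_add {R S : Finset ℤ} (h : R ⊆ S) : val S = val (S \ R) + val R := by
  unfold val; rw [Finset.sum_sdiff h]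

/-- The value of a run of consecutive bits. -/
theorem val_run (β : ℤ) (j : ℕ) :
    val ((Finset.range (j + 1)).image fun i : ℕ => β + (i : ℤ)) = (2 : ℚ) ^ (β + ((j : ℤ) + 1)) - (2 : ℚ) ^ β := by
  unfold val
  rw [Finset.sum_image fun i _ i' _ h => by exact_mod_cast (add_left_cancel h : (i : ℤ) = i'), sum_run_pow β j]

end Summit.Ventures.CertifiedArithmetic.LowPrec.Opt
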